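import Summits.AtomisticToContinuum.Crystallization.Theorems.ChartedZeroExcessLayeredLatticeLiouvilleYEA

/-!
# Charted zero-excess layered-lattice Liouville — YE «SereneCut» — part 2 of 2 (sequel of `…ChartedZeroExcessLayeredLatticeLiouvilleYEA`)

Split for the 400-line cap by the landing lane (hand-2 g32); the module docstring of part 1 (`…ChartedZeroExcessLayeredLatticeLiouvilleYEA`) describes the whole node.  Same namespace; all FQNs unchanged.
0 sorry; standard axioms.
-/

noncomputable section
open scoped BigOperators Classical
open MeasureTheory Set Metric Filter Topology
open Summit.AtomisticToContinuum.Crystallization.Theorems.ChartedPlanarOrderRigidityDoor (E3 atomsIn VisibleGap PertRegime)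
open Summit.AtomisticToContinuum.Crystallization.Theorems.ChartedPlanarOrderDensityDichotomy (μS IsSep nK nK_nonneg)
open Summit.AtomisticToContinuum.Crystallization.Theorems.ChartedPlanarOrderCleanScaleP (IsCleanP IsDoorSetP)
open Summit.AtomisticToContinuum.Crystallization.Theorems.ChartedPlanarOrderMesoCut (LayeredHom EnvClose)
open Summit.AtomisticToContinuum.Crystallization.Theorems.ChartedPlanarOrderDoorLayered (atomsIn_subset sq_le_finsum_mem PeriodicBulkGapDoor)
open Summit.AtomisticToContinuum.Crystallization.Theorems.ChartedPlanarOrderDoorLayeredOsc (IsTwoShellAffineGood)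
open Literature.MathematicalPhysics.StatisticalMechanics (card_le_of_separated_of_dist_le)

namespace Summit.AtomisticToContinuum.Crystallization.Theorems.ChartedZeroExcessLayeredLatticeLiouville

/-! ### YE-1b  The (M) ∧ (K) currency ON TAME BALLS, typed: (MKᵇᵃˡˡ) `TameBallTiltStrainBPG` ⇒ [TBISᵇ(r)] (row 1174 (i)) -/

/-- cubic tilt–strain mass of data `(Q, σ)` on the sites of `W` that have a `ϑ`-tame `r`-ball: `Σ_{x ∈ W, tame ball} (σ x³ + tilt(Q x)³)`. [this file, g62] -/
def tameBallCubicMass (ϑ r : ℝ) (S H : Set E3) (Q : E3 → (E3 ≃ₗᵢ[ℝ] E3)) (σ : E3 → ℝ) (W : Set E3) : ℝ :=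
  ∑ᶠ x ∈ W, if IsTameBall ϑ r S H x then σ x ^ 3 + tilt (Q x) ^ 3 else 0

/-- `tameBallCubicMass_nonneg` for tilt–strain data. [formal bookkeeping] -/
theorem tameBallCubicMass_nonneg {ϑ r : ℝ} {S H : Set E3} {R : ℝ} {Ψ : E3 → E3} {Q : E3 → (E3 ≃ₗᵢ[ℝ] E3)} {σ : E3 → ℝ} (h : IsTiltStrainData S R Ψ Q σ)
    (W : Set E3) : 0 ≤ tameBallCubicMass ϑ r S H Q σ W :=
  finsum_nonneg fun x => finsum_nonneg fun _ => by
    have h0 : 0 ≤ σ x := h.2.1 x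
    have h1 : 0 ≤ tilt (Q x) := tilt_nonneg _
    split_ifs
    · positivity
    · exact le_rfl

/-- ★ **THE BALL-WISE COUNT SHADOW OF (M) ∧ (K) (PROVED)**: for ANY tilt–strain data `(Q, σ)` of `Ψ` on `win R` and `ϑ₁, ω₁ > 0`, the tame-`r`-balled
`(ϑ₁, ω₁)`-incoherent sites number `≤ (ϑ₁⁻³ + ω₁⁻³)·Σ_{tame-balled sites} (σ³ + tilt³)` — a site with `σ x ≤ ϑ₁` and `tilt(Q x) ≤ ω₁` is coherent with `U := Q x`
(part YC `incoherentCount_le_of_tiltStrainData`, localised to the tame-ball sites). [this file, g62] -/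
theorem tameBallIncoherentCount_le_of_tiltStrainData {ϑ₁ ω₁ ϑ r : ℝ} (hϑ₁ : 0 < ϑ₁) (hω₁ : 0 < ω₁) {S H : Set E3} {R : ℝ} (hW : (atomsIn (μS S) 0 R).Finite)
    {Ψ : E3 → E3} {Q : E3 → (E3 ≃ₗᵢ[ℝ] E3)} {σ : E3 → ℝ} (h : IsTiltStrainData S R Ψ Q σ) :
    tameBallIncoherentCount ϑ₁ ω₁ ϑ r S H Ψ (atomsIn (μS S) 0 R) ≤ (1 / ϑ₁ ^ 3 + 1 / ω₁ ^ 3) * tameBallCubicMass ϑ r S H Q σ (atomsIn (μS S) 0 R) := by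
  have hϑ3 : 0 < ϑ₁ ^ 3 := by positivity
  have hω3 : 0 < ω₁ ^ 3 := by positivity
  have hk : 0 ≤ 1 / ϑ₁ ^ 3 + 1 / ω₁ ^ 3 := by positivity
  rw [tameBallIncoherentCount, tameBallCubicMass, finsum_mem_eq_finite_toFinset_sum _ hW, finsum_mem_eq_finite_toFinset_sum _ hW, Finset.mul_sum]
  refine Finset.sum_le_sum fun x hx => ?_
  have hxW : x ∈ atomsIn (μS S) 0 R := hW.mem_toFinset.1 hx
  have hσ0 : 0 ≤ σ x := h.2.1 x
  have ht0 : 0 ≤ tilt (Q x) := tilt_nonneg _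
  have hm : 0 ≤ σ x ^ 3 + tilt (Q x) ^ 3 := by positivity
  by_cases hb : IsTameBall ϑ r S H x
  · rw [if_pos hb]
    by_cases hc : IsCoherentBy ϑ₁ ω₁ S Ψ {x}
    · rw [if_neg (fun h' => h'.2 hc)]
      exact mul_nonneg hk hm
    · rw [if_pos ⟨hb, hc⟩]
      by_cases hσ : σ x ≤ ϑ₁
      · have ht : ¬ tilt (Q x) ≤ ω₁ := fun ht => hc fun y hy => by
          rw [mem_singleton_iff.1 hy]
          exact ⟨Q x, h.1 x, ht, fun p hp hpx => (h.2.2 x hxW p hp hpx).trans hσ⟩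
        have h1 : ω₁ ^ 3 ≤ tilt (Q x) ^ 3 := pow_le_pow_left₀ hω₁.le (not_le.1 ht).le 3
        calc (1 : ℝ) = 1 / ω₁ ^ 3 * ω₁ ^ 3 := by rw [one_div, inv_mul_cancel₀ hω3.ne']
          _ ≤ 1 / ω₁ ^ 3 * tilt (Q x) ^ 3 := mul_le_mul_of_nonneg_left h1 (by positivity)
          _ ≤ (1 / ϑ₁ ^ 3 + 1 / ω₁ ^ 3) * (σ x ^ 3 + tilt (Q x) ^ 3) :=
            mul_le_mul (le_add_of_nonneg_left (by positivity)) (le_add_of_nonneg_left (by positivity)) (by positivity) hk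
      · have h1 : ϑ₁ ^ 3 ≤ σ x ^ 3 := pow_le_pow_left₀ hϑ₁.le (not_le.1 hσ).le 3
        calc (1 : ℝ) = 1 / ϑ₁ ^ 3 * ϑ₁ ^ 3 := by rw [one_div, inv_mul_cancel₀ hϑ3.ne']
          _ ≤ 1 / ϑ₁ ^ 3 * σ x ^ 3 := mul_le_mul_of_nonneg_left h1 (by positivity)
          _ ≤ (1 / ϑ₁ ^ 3 + 1 / ω₁ ^ 3) * (σ x ^ 3 + tilt (Q x) ^ 3) :=
            mul_le_mul (le_add_of_nonneg_right (by positivity)) (le_add_of_nonneg_right (by positivity)) (by positivity) hk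
  · rw [if_neg hb, if_neg (fun h' => hb h'.1), mul_zero]

/-- ★★ **(MKᵇᵃˡˡ) «TameBallTiltStrainBPG ϑ r aHi Λ θ s» — (M) ∧ (K) FOR THE GIVEN `Ψ` ON TAME BALLS, AS ONE DATA LEAF.**  With the B-body's binders (door `S`,
θ-good, `η ≤ η₁`, `R ≥ R₁`, equilibrium chart, `(Cg, η, R)`-registered bond isomorphism `Ψ`, `K₀`-fat window): there are tilt–strain data `(Q, σ)` of `Ψ` on `win R`
(part TR `IsTiltStrainData`: rotations `Q x` of determinant `1` and a strain profile `σ` dominating the misfit of every `4`-bond at `x` to `v ↦ Ψ x + Q x v`) whose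
CUBIC MASS ON THE TAME-`r`-BALLED SITES is small: `Σ_{x ∈ win R, IsTameBall ϑ r S H x} (σ x³ + tilt(Q x)³) ≤ ε·η·nK(win R)`.  This is the typed target of the
(M)/(K) provers in exactly the form their mechanism produces — (K) rigidity (Friesecke–James–Müller in `L³`, cellwise on balls of `ϑ`-tame θ-good stars:
ONE rotation per ball, `Σ‖Q x − Q̄‖³ ≲ Σσ³`) and (M) smallness of the strain of the GIVEN bond-isomorphic `Ψ` away from the hot set (interior estimates for
the equilibrium system linearised at the chart on tame balls — the column's generic leaves `L2HarmonicApproxPE` / `PositionCaccioppoliPGE` / `PositionDecayPLE`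
— fed by the registration budget `Σσ² ≲ Cg·η·nK` at every scale `≥ R`: a site whose tame ball has radius `ρ` carries `σ ≲ C·(Cg·η·(R/ρ)³)^{1/2} +` the far
field of the hot set) — and it needs NO hypothesis near hot sites: the mass is summed over tame-balled sites only.  ⇒ [TBISᵇ(r)](ϑ₁, ω₁) for every `ϑ₁, ω₁ > 0`
(`tameBallIncoherenceSparseBPG_of_tameBallTiltStrain`, PROVED, cubic Chebyshev); hence with [HSᵇ]: [TISᵇ] and [ISᵇ₀] (row 1174 (i), fully typed:
`tameIncoherenceSparseBPG_of_hot_tameBallTiltStrain`).  SIDE DOOR (a sufficient condition, STRONGER than [TBISᵇ(r)]; not in the column) · (M)/(K)-currency ·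
GENERIC · UNDECIDED · INSTRUMENTABLE ((F1)+(F0c) restricted to tame `8`-balls) · ATTACKABLE·L.
Why it might fail: Gehring-type higher integrability on balls of FIXED radius only improves constants (`O(η)`); the `o(η)` is carried by interior DECAY at
growing distance from the hot set, so the inhabitants are percent-level far fields of FAT hot structures (hot radius `≳ 11`, continuum dipole decay
`(1/20)(q/(q+d))³ > 1/100` at `d ≥ 8`) and boundary-driven high-multipole strain in windows adjacent to them — warm fraction `≍ 10³·η` there — i.e. it
fails exactly if fat hot structures exist in e⋆-GSC door sets at density `≍ η` (the [T]-type enclosure bet: they do not).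
Sources: part TR ((K) `TiltRigidityP`, (M), `IsTiltStrainData`); part UI ((Mᵇ)); part YC (`incoherentCount_le_of_tiltStrainData`); Friesecke–James–Müller,
Comm. Pure Appl. Math. 55 (2002) Thm 3.1; Conti–Schweizer, Comm. Pure Appl. Math. 59 (2006); E–Ming, Arch. Ration. Mech. Anal. 183 (2007) 241; Giaquinta–Modica
(1979) / [giaquinta1984 Ch. V]; CRITIC-LEDGER row 1174 (i). [this file, g62] -/
def TameBallTiltStrainBPG (ϑ r aHi Λ θ s : ℝ) : Prop :=
  ∀ δ : ℝ, 0 < δ → ∀ a : ℝ, 0 < a → ∀ Cg : ℝ, 1 ≤ Cg →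
    ∀ ε : ℝ, 0 < ε → ∀ K₀ : ℝ, 0 < K₀ → ∃ η₁ : ℝ, 0 < η₁ ∧ ∃ R₁ : ℝ, 0 < R₁ ∧
      ∀ S : Set E3, IsDoorSetPG aHi δ S → (∀ q ∈ S, IsTwoShellAffineGood θ S q) →
        ∀ η : ℝ, 0 < η → η ≤ η₁ → ∀ R : ℝ, R₁ ≤ R →
          ∀ (L : E3 ≃L[ℝ] E3) (w : ℤ → E3), IsEquilChart a s Λ L w →
            ∀ Ψ : E3 → E3, IsGlobalReg Cg η R S (LayeredHom (L : E3 →L[ℝ] E3) w) Ψ → IsBondIso S Ψ →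
              K₀ ≤ η * nK (atomsIn (μS S) 0 R) →
                ∃ (Q : E3 → (E3 ≃ₗᵢ[ℝ] E3)) (σ : E3 → ℝ), IsTiltStrainData S R Ψ Q σ ∧
                  tameBallCubicMass ϑ r S (LayeredHom (L : E3 →L[ℝ] E3) w) Q σ (atomsIn (μS S) 0 R) ≤ ε * η * nK (atomsIn (μS S) 0 R)

/-- ★★ **(MKᵇᵃˡˡ)(ϑ, r) ⇒ [TBISᵇ(r)](ϑ₁, ω₁, ϑ) for all `ϑ₁, ω₁ > 0` (PROVED)** — cubic Chebyshev on the tame-balled sites, `ε := εw/(ϑ₁⁻³ + ω₁⁻³)`. [this file, g62] -/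
theorem tameBallIncoherenceSparseBPG_of_tameBallTiltStrain {ϑ₁ ω₁ ϑ r aHi Λ θ s : ℝ} (hϑ₁ : 0 < ϑ₁) (hω₁ : 0 < ω₁) (h : TameBallTiltStrainBPG ϑ r aHi Λ θ s) :
    TameBallIncoherenceSparseBPG ϑ₁ ω₁ ϑ r aHi Λ θ s := by
  intro δ hδ a ha Cg hCg εw hεw K₀ hK₀
  have hk : 0 < 1 / ϑ₁ ^ 3 + 1 / ω₁ ^ 3 := by positivity
  obtain ⟨η₁, hη₁, R₁, hR₁, h1⟩ := h δ hδ a ha Cg hCg (εw / (1 / ϑ₁ ^ 3 + 1 / ω₁ ^ 3)) (div_pos hεw hk) K₀ hK₀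
  refine ⟨η₁, hη₁, R₁, hR₁, fun S hS hgood η hη hηle R hR L w hLw Ψ hΨ hBI hfat => ?_⟩
  obtain ⟨Q, σ, hd, hm⟩ := h1 S hS hgood η hη hηle R hR L w hLw Ψ hΨ hBI hfat
  calc tameBallIncoherentCount ϑ₁ ω₁ ϑ r S (LayeredHom (L : E3 →L[ℝ] E3) w) Ψ (atomsIn (μS S) 0 R)
      ≤ (1 / ϑ₁ ^ 3 + 1 / ω₁ ^ 3) * tameBallCubicMass ϑ r S (LayeredHom (L : E3 →L[ℝ] E3) w) Q σ (atomsIn (μS S) 0 R) :=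
        tameBallIncoherentCount_le_of_tiltStrainData hϑ₁ hω₁ (finite_atomsIn hδ hS.1.2.1 R) hd
    _ ≤ (1 / ϑ₁ ^ 3 + 1 / ω₁ ^ 3) * (εw / (1 / ϑ₁ ^ 3 + 1 / ω₁ ^ 3) * η * nK (atomsIn (μS S) 0 R)) := mul_le_mul_of_nonneg_left hm hk.le
    _ = εw * η * nK (atomsIn (μS S) 0 R) := by
        field_simp

/-- ★★ **ROW 1174 (i) FULLY TYPED (PROVED): [HSᵇ](ϑ) ∧ (MKᵇᵃˡˡ)(ϑ, r) ⇒ [TISᵇ](ϑ₁, ω₁, ϑ)** (`aHi ≤ 8/7`, `r ≥ 0`, `ϑ₁, ω₁ > 0`): (M)/(K) for `Ψ` on tame BALLS plus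
hot-neighbourhood absorption. [this file, g62] -/
theorem tameIncoherenceSparseBPG_of_hot_tameBallTiltStrain {ϑ₁ ω₁ ϑ r aHi Λ θ s : ℝ} (haHi : aHi ≤ 8 / 7) (hr : 0 ≤ r) (hϑ₁ : 0 < ϑ₁) (hω₁ : 0 < ω₁)
    (hH : HotSparseBPG ϑ aHi Λ θ s) (hMK : TameBallTiltStrainBPG ϑ r aHi Λ θ s) : TameIncoherenceSparseBPG ϑ₁ ω₁ ϑ aHi Λ θ s :=
  tameIncoherenceSparseBPG_of_hot_tameBallIncoherent haHi hr hH (tameBallIncoherenceSparseBPG_of_tameBallTiltStrain hϑ₁ hω₁ hMK)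

/-! ### YE-2  The SERENE / AGITATED cut of [BHSᵇ]: far-warm observers, [FWSᵇ], [SBHSᵇ], `[BHSᵇ] ⟸ [SBHSᵇ] ∧ [FWSᵇ]`, column `_16XH23B` -/

/-- **`IsFarWarm ϑc ϑ r S H y`** — a TAME OBSERVER THAT SEES STRAIN: the `r`-ball of `y` is `ϑ`-tame (no hot site within `r`) but the star of `y` is not `ϑc`-tame. [this file, g62] -/
def IsFarWarm (ϑc ϑ r : ℝ) (S H : Set E3) (y : E3) : Prop := IsTameBall ϑ r S H y ∧ ¬ IsTameStar ϑc S H y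

/-- **`IsAgitated ϑc ϑ r ra S H x`** — some far-warm site of `S` lies within `ra` of `x`: the far field around `x` is OBSERVABLY strained.  Its negation is SERENITY (every
tame-balled observer within `ra` is `ϑc`-cool — or there is none). [this file, g62] -/
def IsAgitated (ϑc ϑ r ra : ℝ) (S H : Set E3) (x : E3) : Prop := ∃ y ∈ S, dist y x ≤ ra ∧ IsFarWarm ϑc ϑ r S H y

/-- number of far-warm sites of `Q`. [this file, g62] -/
def farWarmCount (ϑc ϑ r : ℝ) (S H Q : Set E3) : ℝ :=
  ∑ᶠ x ∈ Q, if IsFarWarm ϑc ϑ r S H x then (1 : ℝ) else 0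

/-- number of agitated sites of `Q`. [this file, g62] -/
def agitatedCount (ϑc ϑ r ra : ℝ) (S H Q : Set E3) : ℝ :=
  ∑ᶠ x ∈ Q, if IsAgitated ϑc ϑ r ra S H x then (1 : ℝ) else 0

/-- number of SERENE BARE HOT sites of `Q`: not dressed, not `ϑ`-tame, not agitated. [this file, g62] -/
def sereneBareHotCount (ϑc ϑ r ra ϑe ωe : ℝ) (p : ℕ) (r₀ ℓ : ℝ) (M : ℕ) (S H Q : Set E3) : ℝ :=
  ∑ᶠ x ∈ Q, if IsDressed ϑe ωe p r₀ ℓ M S H x ∨ IsTameStar ϑ S H x ∨ IsAgitated ϑc ϑ r ra S H x then (0 : ℝ) else 1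

/-- `farWarmCount_nonneg`. [formal bookkeeping] -/
theorem farWarmCount_nonneg (ϑc ϑ r : ℝ) (S H Q : Set E3) : 0 ≤ farWarmCount ϑc ϑ r S H Q :=
  finsum_nonneg fun x => finsum_nonneg fun _ => by split_ifs <;> norm_num

/-- `agitatedCount_nonneg`. [formal bookkeeping] -/
theorem agitatedCount_nonneg (ϑc ϑ r ra : ℝ) (S H Q : Set E3) : 0 ≤ agitatedCount ϑc ϑ r ra S H Q :=
  finsum_nonneg fun x => finsum_nonneg fun _ => by split_ifs <;> norm_num

/-- `sereneBareHotCount_nonneg`. [formal bookkeeping] -/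
theorem sereneBareHotCount_nonneg (ϑc ϑ r ra ϑe ωe : ℝ) (p : ℕ) (r₀ ℓ : ℝ) (M : ℕ) (S H Q : Set E3) :
    0 ≤ sereneBareHotCount ϑc ϑ r ra ϑe ωe p r₀ ℓ M S H Q :=
  finsum_nonneg fun x => finsum_nonneg fun _ => by split_ifs <;> norm_num

/-- `farWarmCount` is monotone in the window. [formal bookkeeping] -/
theorem farWarmCount_mono {ϑc ϑ r : ℝ} {S H Q Q' : Set E3} (hQ' : Q'.Finite) (h : Q ⊆ Q') : farWarmCount ϑc ϑ r S H Q ≤ farWarmCount ϑc ϑ r S H Q' :=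
  finsum_mem_le_finsum_mem_of_subset_of_nonneg hQ' h fun x _ => by split_ifs <;> norm_num

/-- excluded middle (PROVED): bare-hot ⊆ serene-bare-hot ∪ agitated. [this file, g62] -/
theorem bareHotCount_le_serene_add_agitated {ϑc ϑ r ra ϑe ωe : ℝ} {p : ℕ} {r₀ ℓ : ℝ} {M : ℕ} {S H Q : Set E3} (hQ : Q.Finite) :
    bareHotCount ϑ ϑe ωe p r₀ ℓ M S H Q ≤ sereneBareHotCount ϑc ϑ r ra ϑe ωe p r₀ ℓ M S H Q + agitatedCount ϑc ϑ r ra S H Q := by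
  rw [bareHotCount, sereneBareHotCount, agitatedCount, finsum_mem_eq_finite_toFinset_sum _ hQ, finsum_mem_eq_finite_toFinset_sum _ hQ,
    finsum_mem_eq_finite_toFinset_sum _ hQ, ← Finset.sum_add_distrib]
  refine Finset.sum_le_sum fun x _ => ?_
  have hs : (0 : ℝ) ≤ (if IsDressed ϑe ωe p r₀ ℓ M S H x ∨ IsTameStar ϑ S H x ∨ IsAgitated ϑc ϑ r ra S H x then (0 : ℝ) else 1) := by
    split_ifs <;> norm_num
  have hb : (0 : ℝ) ≤ (if IsAgitated ϑc ϑ r ra S H x then (1 : ℝ) else 0) := by split_ifs <;> norm_num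
  by_cases hd : IsDressed ϑe ωe p r₀ ℓ M S H x ∨ IsTameStar ϑ S H x
  · rw [if_pos hd]
    exact add_nonneg hs hb
  · rw [if_neg hd]
    by_cases hag : IsAgitated ϑc ϑ r ra S H x
    · rw [if_pos hag]
      linarith
    · rw [if_neg hag, if_neg (fun h' => h'.elim (fun h₁ => hd (Or.inl h₁)) (fun h₂ => h₂.elim (fun h₃ => hd (Or.inr h₃)) hag))]
      norm_num

/-- CHARGING (PROVED): `agitatedCount(win R) ≤ (2ra/δ+1)³ · farWarmCount(win (R + ra))` — each far-warm observer agitates `≤ (2ra/δ+1)³` sites. [this file, g62] -/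
theorem agitatedCount_le_packing_mul_farWarmCount {δ : ℝ} (hδ : 0 < δ) {S : Set E3} (hsep : IsSep δ S) {ϑc ϑ r R ra : ℝ} (hra : 0 ≤ ra) (H : Set E3) :
    agitatedCount ϑc ϑ r ra S H (atomsIn (μS S) 0 R) ≤ (2 * ra / δ + 1) ^ 3 * farWarmCount ϑc ϑ r S H (atomsIn (μS S) 0 (R + ra)) := by
  have hg1 : ∀ x : E3, (if IsAgitated ϑc ϑ r ra S H x then (1 : ℝ) else 0) ≤ 1 := fun x => by split_ifs <;> norm_num
  have hgP : ∀ x : E3, 0 < (if IsAgitated ϑc ϑ r ra S H x then (1 : ℝ) else 0) → ∃ y ∈ S, dist y x ≤ ra ∧ IsFarWarm ϑc ϑ r S H y := by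
    intro x hx
    by_contra h
    have h' : ¬ IsAgitated ϑc ϑ r ra S H x := h
    rw [if_neg h'] at hx
    exact lt_irrefl _ hx
  have hf0 : ∀ y : E3, (0 : ℝ) ≤ (if IsFarWarm ϑc ϑ r S H y then (1 : ℝ) else 0) := fun y => by split_ifs <;> norm_num
  have hf1 : ∀ y : E3, IsFarWarm ϑc ϑ r S H y → (1 : ℝ) ≤ (if IsFarWarm ϑc ϑ r S H y then (1 : ℝ) else 0) := fun y hy => by rw [if_pos hy]
  exact winsum_le_packing_mul_winsum hδ hsep hra (fun y => IsFarWarm ϑc ϑ r S H y) hg1 hgP hf0 hf1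

/-- DICTIONARY (PROVED): a far-warm site is tame-ball-incoherent once `ϑ₁ ≤ ϑc` — a `(ϑ₁, ω₁)`-coherent star is `ϑ₁`-tame (part YC `IsCoherentBy.isTameOn_of_le`), hence
`ϑc`-tame. [this file, g62] -/
theorem farWarmCount_le_tameBallIncoherentCount {ϑ₁ ω₁ ϑc ϑ r : ℝ} {S H Q : Set E3} {Ψ : E3 → E3} (hQ : Q.Finite) (hΨ : MapsTo Ψ S H) (hϑ : ϑ₁ ≤ ϑc) :
    farWarmCount ϑc ϑ r S H Q ≤ tameBallIncoherentCount ϑ₁ ω₁ ϑ r S H Ψ Q := by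
  rw [farWarmCount, tameBallIncoherentCount, finsum_mem_eq_finite_toFinset_sum _ hQ, finsum_mem_eq_finite_toFinset_sum _ hQ]
  refine Finset.sum_le_sum fun x _ => ?_
  by_cases h : IsFarWarm ϑc ϑ r S H x
  · have hnc : ¬ IsCoherentBy ϑ₁ ω₁ S Ψ {x} := fun hc => h.2 ((hc.isTameOn_of_le hΨ hϑ) x (mem_singleton x))
    rw [if_pos h, if_pos ⟨h.1, hnc⟩]
  · rw [if_neg h]
    split_ifs <;> norm_num

/-- sub-count (PROVED): serene-bare-hot ⊆ bare-hot. [this file, g62] -/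
theorem sereneBareHotCount_le_bareHotCount {ϑc ϑ r ra ϑe ωe : ℝ} {p : ℕ} {r₀ ℓ : ℝ} {M : ℕ} {S H Q : Set E3} (hQ : Q.Finite) :
    sereneBareHotCount ϑc ϑ r ra ϑe ωe p r₀ ℓ M S H Q ≤ bareHotCount ϑ ϑe ωe p r₀ ℓ M S H Q := by
  rw [sereneBareHotCount, bareHotCount, finsum_mem_eq_finite_toFinset_sum _ hQ, finsum_mem_eq_finite_toFinset_sum _ hQ]
  refine Finset.sum_le_sum fun x _ => ?_
  by_cases hd : IsDressed ϑe ωe p r₀ ℓ M S H x ∨ IsTameStar ϑ S H x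
  · rw [if_pos hd, if_pos (hd.elim (fun h₁ => Or.inl h₁) (fun h₂ => Or.inr (Or.inl h₂)))]
  · rw [if_neg hd]
    split_ifs <;> norm_num

/-- ★ **[FWSᵇ] «FarWarmSparseBPG ϑc ϑ r aHi Λ θ s» — FAR-WARM OBSERVERS ARE `o(η)`-SPARSE**: with the B-body's binders, the sites of `win R` whose `r`-ball is `ϑ`-tame but whose
star is not `ϑc`-tame number `≤ εw·η·nK(win R)`.  Registration-blind in its conclusion; IMPLIED by [TBISᵇ(r)](ϑ₁, ω₁, ϑ) for `ϑ₁ ≤ ϑc` (`farWarmSparseBPG_of_tameBallIncoherence`,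
PROVED) — so it costs the column NOTHING beyond [TBISᵇ]; it is the (M)-currency in its purest form (higher integrability of the strain on tame balls, no orientation content).
NEW as a typed leaf · (M)-currency · UNDECIDED((F0c) «WarmScan» restricted to tame `8`-balls) · INSTRUMENTABLE · ATTACKABLE·L.
Why it might fail: as [TBISᵇ(r)] (elastic halos of sources at density `≍ η`).
Sources: part YC ([WSᵇ], `IsCoherentBy.isTameOn_of_le`); this file ([TBISᵇ(r)]). [this file, g62] -/
def FarWarmSparseBPG (ϑc ϑ r aHi Λ θ s : ℝ) : Prop :=
  CountSparseBPG (fun S H _ Q => farWarmCount ϑc ϑ r S H Q) aHi Λ θ s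

/-- ★★ **[SBHSᵇ] «SereneBareHotSparseBPG ϑc ϑ r ra ϑe ωe p r₀ ℓ M aHi Λ θ s» — SERENE BARE HOT SITES ARE `o(η)`-SPARSE** (the SPECIAL class of the lens-2 cut of [BHSᵇ]):
with the B-body's binders, the sites of `win R` that are BARE (`¬ IsDressed`, part UG), HOT (not `ϑ`-tame) and SERENE (no far-warm observer within `ra`: wherever the far field of
the hot network around the site is observable on a `ϑ`-tame `r`-ball, it is `ϑc`-COOL) number `≤ εw·η·nK(win R)`.  WEAKER than [BHSᵇ] (`sereneBareHotSparseBPG_of_bareHot`, sub-count,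
PROVED); with [FWSᵇ] — hence with [TBISᵇ(r)] — it gives [BHSᵇ] back (`bareHotSparseBPG_of_serene_farWarm`, PROVED).  MECHANISM (IDEA-NAMED, the typed home of [BHSᵇ]'s «source
chains» MINUS the sources): a serene bare hot network is SELF-EQUILIBRATED (screened far field), so the e⋆-GSC EXCISION calculus runs with a controlled ambient term — (E1) LOCAL HOT
GAP: the null-Lagrangian-corrected cell excess of a `ϑ`-hot star in the charted fixed-topology class is `≥ c·ϑ²` (finite, certified, computer-assistable; cf. Flatley–Theil FCC/HCP
local optimality, the lens-5 two-shell cells); (E2) FEATHERED EXCISION: replace the network (thin tube of length `N` and thickness `ρ`, sheet, small lump) by the chart inside a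
collar of width `r`, feathering cost `≲ (ρ/r)²·` gain, cut ends `O(1)`; (E3) AMBIENT COUPLING `≤ C·σ_amb·ϑ·N` with `σ_amb ≤ ϑc` BY SERENITY; so serene networks thin relative to `r`
are removable once `ϑc ≤ c·ϑ/C`, contradicting GSC — their count should be ZERO, not just `o(η)`.  Honest residual inhabitant: BURIED interiors of FAT hot lumps (inradius `> r + ra`,
vacuously serene) — by volume-vs-surface with a STRAINED tame patch, removable when the ambient strain at the rind is `< ϑ·√(c/C)`; marginal between that and `ϑ` (a stress-induced
competing phase at `5 %` strain is the bet against; none for Lennard-Jones-type pair potentials).  NEW · GSC-priced · UNDECIDED(stated test: census «SereneScan» — per bare hot site,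
far-warm sites within `16`: prediction agitated ⊋ dislocation / misfit cores, serene = ∅ in relaxed defected windows) · INSTRUMENTABLE · IDEA-NAMED ((E1)–(E3)) · ATTACKABLE·M on thin
networks and on fat lumps in cool ambient.
Why it might fail: a SCREENED self-equilibrated hot network whose corrected cell excess is NOT additive (sources screening each other inside the collar so that (E1) fails
collectively though it holds per cell) at density `≍ η`; or fat hot lumps stabilised by rind strain `∈ (ϑ√(c/C), ϑ)` at volume fraction `≍ η`.  None known, none seen.
Sources: part YD ([BHSᵇ]); part UG ([T_b], dressing); part TP (`UniformTameStability`); Theil, Comm. Math. Phys. 262 (2006) 209; Flatley–Theil, Arch. Ration. Mech. Anal. 218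
(2015) 363 (arXiv 1407.0692); E–Ming, Arch. Ration. Mech. Anal. 183 (2007) 241; Braun–Hudson–Ortner, arXiv 2108.04765 (far fields of screened / charged lattice defects);
Ehrlacher–Ortner–Shapeev, Arch. Ration. Mech. Anal. 222 (2016) 1217; CRITIC-LEDGER row 1174 (ii). [this file, g62] -/
def SereneBareHotSparseBPG (ϑc ϑ r ra ϑe ωe : ℝ) (p : ℕ) (r₀ ℓ : ℝ) (M : ℕ) (aHi Λ θ s : ℝ) : Prop :=
  CountSparseBPG (fun S H _ Q => sereneBareHotCount ϑc ϑ r ra ϑe ωe p r₀ ℓ M S H Q) aHi Λ θ s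

/-- ★★ **GLUE (PROVED): [SBHSᵇ] ∧ [FWSᵇ] ⇒ [BHSᵇ]** on `aHi ≤ 8/7` door sets, `ra ≥ 0` — the agitated bare hot sites are charged to the far-warm observers of `win (R + ra)`
through the charging glue. [this file, g62] -/
theorem bareHotSparseBPG_of_serene_farWarm {ϑc ϑ r ra ϑe ωe : ℝ} {p : ℕ} {r₀ ℓ : ℝ} {M : ℕ} {aHi Λ θ s : ℝ} (haHi : aHi ≤ 8 / 7) (hra : 0 ≤ ra)
    (hS' : SereneBareHotSparseBPG ϑc ϑ r ra ϑe ωe p r₀ ℓ M aHi Λ θ s) (hF : FarWarmSparseBPG ϑc ϑ r aHi Λ θ s) :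
    BareHotSparseBPG ϑ ϑe ωe p r₀ ℓ M aHi Λ θ s :=
  bareHotSparseBPG_iff_count.2
    (CountSparseBPG.of_le_add_mul (cntA := fun S H _ Q => bareHotCount ϑ ϑe ωe p r₀ ℓ M S H Q)
      (cntB := fun S H _ Q => sereneBareHotCount ϑc ϑ r ra ϑe ωe p r₀ ℓ M S H Q) (cntC := fun S H _ Q => farWarmCount ϑc ϑ r S H Q)
      (C := fun δ => (2 * ra / δ + 1) ^ 3) haHi (fun δ _ => by positivity)
      (fun δ hδ S hsep H Ψ R => (bareHotCount_le_serene_add_agitated (finite_atomsIn hδ hsep R)).trans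
        (add_le_add le_rfl (agitatedCount_le_packing_mul_farWarmCount hδ hsep hra H)))
      (fun _ _ _ _ _ hQ' hQQ' => farWarmCount_mono hQ' hQQ') hS' hF)

/-- **[TBISᵇ(r)](ϑ₁, ω₁, ϑ) ⇒ [FWSᵇ](ϑc, ϑ, r) for `ϑ₁ ≤ ϑc` (PROVED)** — the observers' leaf is already in the column. [this file, g62] -/
theorem farWarmSparseBPG_of_tameBallIncoherence {ϑ₁ ω₁ ϑc ϑ r aHi Λ θ s : ℝ} (hϑ : ϑ₁ ≤ ϑc) (h : TameBallIncoherenceSparseBPG ϑ₁ ω₁ ϑ r aHi Λ θ s) :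
    FarWarmSparseBPG ϑc ϑ r aHi Λ θ s :=
  CountSparseBPG.of_pointwise_le (fun _ _ _ _ hQ _ hΨ => farWarmCount_le_tameBallIncoherentCount hQ hΨ hϑ) h

/-- **[BHSᵇ] ⇒ [SBHSᵇ] (PROVED)** — the new leaf is WEAKER (sub-count). [this file, g62] -/
theorem sereneBareHotSparseBPG_of_bareHot {ϑc ϑ r ra ϑe ωe : ℝ} {p : ℕ} {r₀ ℓ : ℝ} {M : ℕ} {aHi Λ θ s : ℝ} (h : BareHotSparseBPG ϑ ϑe ωe p r₀ ℓ M aHi Λ θ s) :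
    SereneBareHotSparseBPG ϑc ϑ r ra ϑe ωe p r₀ ℓ M aHi Λ θ s :=
  CountSparseBPG.of_pointwise_le (fun _ _ _ _ hQ _ _ => sereneBareHotCount_le_bareHotCount hQ) (bareHotSparseBPG_iff_count.1 h)

/-- ★★ **[SBHSᵇ](ϑc) ∧ [TBISᵇ(r)](ϑ₁) ⇒ [BHSᵇ] for `ϑ₁ ≤ ϑc` (PROVED)** — the lens-2 cut of the IDEA-NEEDED leaf with its generic class paid in (M)-currency. [this file, g62] -/
theorem bareHotSparseBPG_of_serene_tameBallIncoherence {ϑ₁ ω₁ ϑc ϑ r ra ϑe ωe : ℝ} {p : ℕ} {r₀ ℓ : ℝ} {M : ℕ} {aHi Λ θ s : ℝ} (haHi : aHi ≤ 8 / 7)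
    (hra : 0 ≤ ra) (hϑ : ϑ₁ ≤ ϑc) (hS' : SereneBareHotSparseBPG ϑc ϑ r ra ϑe ωe p r₀ ℓ M aHi Λ θ s) (hT : TameBallIncoherenceSparseBPG ϑ₁ ω₁ ϑ r aHi Λ θ s) :
    BareHotSparseBPG ϑ ϑe ωe p r₀ ℓ M aHi Λ θ s :=
  bareHotSparseBPG_of_serene_farWarm haHi hra hS' (farWarmSparseBPG_of_tameBallIncoherence hϑ hT)

/-- ★★ **[I_D] ∧ [SBHSᵇ] ∧ [TBISᵇ(r)] ⇒ [ISᵇ₀] (PROVED)** (`aHi ≤ 8/7`, `r, ra ≥ 0`, `ϑ₁ ≤ ϑc`): [BHSᵇ] by the serene cut, [HSᵇ] by part YD's dressing glue, [ISᵇ₀] by the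
ball glue — [TBISᵇ(r)] is used TWICE (observers and incoherence). [this file, g62] -/
theorem incoherenceSparseBPG₀_of_dressedCore_serene_tameBallIncoherent {ϑ₁ ω₁ ϑc ϑ r ra ϑe ωe : ℝ} {p : ℕ} {r₀ ℓ : ℝ} {M : ℕ} {aHi Λ θ s : ℝ}
    (haHi : aHi ≤ 8 / 7) (hr : 0 ≤ r) (hra : 0 ≤ ra) (hϑ : ϑ₁ ≤ ϑc) (hI : DressedCorePG ϑ ϑe ωe p r₀ ℓ M aHi Λ θ s)
    (hS' : SereneBareHotSparseBPG ϑc ϑ r ra ϑe ωe p r₀ ℓ M aHi Λ θ s) (hT : TameBallIncoherenceSparseBPG ϑ₁ ω₁ ϑ r aHi Λ θ s) :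
    IncoherenceSparseBPG₀ ϑ₁ ω₁ aHi Λ θ s :=
  incoherenceSparseBPG₀_of_hot_tameBallIncoherent haHi hr
    (hotSparseBPG_of_dressedCore_bareHot hI (bareHotSparseBPG_of_serene_tameBallIncoherence haHi hra hϑ hS' hT)) hT

/-- **THE COUNT DOCKET OF RECORD ⇒ THE SERENE DOCKET (PROVED)**: [BHSᵇ] ∧ [TISᵇ] give [SBHSᵇ] ∧ [TBISᵇ(r)] (`r ≥ 0`) — each new hypothesis is WEAKER than the one it
replaces; with part YD's `bareHotSparse_and_tameIncoherenceSparse_of_record` the sup-norm docket [I_D] ∧ [T_bᵇ] ∧ [W_Ψᵇ₁] implies it too. [this file, g62] -/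
theorem serene_and_tameBall_of_count_docket {ϑ₁ ω₁ ϑc ϑ r ra ϑe ωe : ℝ} {p : ℕ} {r₀ ℓ : ℝ} {M : ℕ} {aHi Λ θ s : ℝ} (hr : 0 ≤ r)
    (hB : BareHotSparseBPG ϑ ϑe ωe p r₀ ℓ M aHi Λ θ s) (hT : TameIncoherenceSparseBPG ϑ₁ ω₁ ϑ aHi Λ θ s) :
    SereneBareHotSparseBPG ϑc ϑ r ra ϑe ωe p r₀ ℓ M aHi Λ θ s ∧ TameBallIncoherenceSparseBPG ϑ₁ ω₁ ϑ r aHi Λ θ s :=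
  ⟨sereneBareHotSparseBPG_of_bareHot hB, tameBallIncoherenceSparseBPG_of_tameIncoherence hr hT⟩

/-- the sup-norm docket of record ⇒ the serene docket (PROVED). [this file, g62] -/
theorem serene_and_tameBall_of_record {ϑ₁ ω₁ ϑc ϑ r ra ϑe ωe : ℝ} {p : ℕ} {r₀ ℓ : ℝ} {M : ℕ} {aHi Λ θ s : ℝ} (hr : 0 ≤ r)
    (hI : DressedCorePG ϑ ϑe ωe p r₀ ℓ M aHi Λ θ s) (hTb : BareTameWindowBPG ϑ ϑe ωe p r₀ ℓ M aHi Λ θ s) (hW : CoherentWindowPsiBPG₁ ϑ₁ ω₁ ϑ aHi Λ θ s) :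
    SereneBareHotSparseBPG ϑc ϑ r ra ϑe ωe p r₀ ℓ M aHi Λ θ s ∧ TameBallIncoherenceSparseBPG ϑ₁ ω₁ ϑ r aHi Λ θ s :=
  serene_and_tameBall_of_count_docket hr (bareHotSparse_and_tameIncoherenceSparse_of_record hI hTb hW).1
    (bareHotSparse_and_tameIncoherenceSparse_of_record hI hTb hW).2

/-- (R_Wᵇ) from [I_D] ∧ [SBHSᵇ] ∧ [TBISᵇ(r)] under the side condition (PROVED). [this file, g62] -/
theorem wildFractionBPG_of_dressedCore_serene_tameBallIncoherent {ϑ₁ ω₁ ϑc ϑ r ra ϑe ωe : ℝ} {p : ℕ} {r₀ ℓ : ℝ} {M : ℕ} {aHi Λ θ s : ℝ}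
    (hside : 4 * ω₁ + ϑ₁ < tameRadius) (haHi : aHi ≤ 8 / 7) (hr : 0 ≤ r) (hra : 0 ≤ ra) (hϑ : ϑ₁ ≤ ϑc)
    (hI : DressedCorePG ϑ ϑe ωe p r₀ ℓ M aHi Λ θ s) (hS' : SereneBareHotSparseBPG ϑc ϑ r ra ϑe ωe p r₀ ℓ M aHi Λ θ s)
    (hT : TameBallIncoherenceSparseBPG ϑ₁ ω₁ ϑ r aHi Λ θ s) : WildFractionBPG aHi Λ θ s :=
  wildFractionBPG_of_sparse₀ hside (incoherenceSparseBPG₀_of_dressedCore_serene_tameBallIncoherent haHi hr hra hϑ hI hS' hT)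

/-- ★★★ **COLUMN `_16XH23B`** — `_16XH22Bᶜ` with [BHSᵇ] replaced by the SERENE leaf [SBHSᵇ](ϑc = 1/100, ϑ = tameRadius, r = 8, ra = 16) `SereneBareHotSparseBPG (1/100) tameRadius
8 16 dressLevel dressLevel dressExponent 8 collarRadius clusterSize 1 2 (1/16) (1/50)` and [TISᵇ] replaced by the BALL leaf [TBISᵇ(8)] `TameBallIncoherenceSparseBPG (1/100) (1/200)
tameRadius 8 1 2 (1/16) (1/50)`; [I_D] kept; 20 generic leaves + `PeriodicBulkGapDoor 2` ⇒ `VisibleGap (1/50) ∧ PertRegime (1/50)`.  Each new hypothesis is implied by the one it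
replaces (`serene_and_tameBall_of_count_docket`, PROVED); the AGITATED bare hot sites and the hot neighbourhoods are paid by leaves already present. [this file, g62] -/
theorem gap_and_pert_1_50_of_certs_16XH23B (hL : LatticeLiouvilleCert) (hL' : LayeredLiouvilleCert)
    (hR : OscRigidityL2BDPG 1 2 (1 / 16) (1 / 16)) (hX : ExcessFlatnessControlP 1 2 (1 / 16) (1 / 16))
    (hE : ExcessChartLocalisationP 1 2 (1 / 16) (1 / 100)) (hP : RegistrationP 1 2 (1 / 16) (1 / 100))
    (hT : TailDominationCert) (hU : UniformTameStabilityE (1 / 50) 2 (1 / 2000))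
    (h1 : WordTransplantP 1 2 (1 / 16) (1 / 100)) (hGT : GradReframingThickP 1 2 (1 / 16) (1 / 100) (1 / 50))
    (hΛ0 : LaunderingAprioriPX 1 2 (1 / 16) (1 / 100) (1 / 50)) (hΛs : LaunderingStepPX 1 2 (1 / 16) (1 / 100) (1 / 50))
    (hUc : UntwistCollarP 1 2 (1 / 16) (1 / 50))
    (hl : BondIsoLevelsP 1 2 (1 / 16) (1 / 50)) (hN : EnergyNearChartPX 1 2 (1 / 16) (1 / 50) (1 / 2000))
    (hF : TailForceSlavingP 1 2 (1 / 16) (1 / 50))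
    (hE' : LipDualLinearisationP 1 2 (1 / 16) (1 / 50)) (hA : L2HarmonicApproxPE 1 2 (1 / 16) (1 / 50) (1 / 2000))
    (hD : PositionDecayPLE 1 2 (1 / 16) (1 / 50) (1 / 2000)) (hC : PositionCaccioppoliPGE 1 2 (1 / 16) (1 / 50) (1 / 2000))
    (hI : DressedCorePG tameRadius dressLevel dressLevel dressExponent 8 collarRadius clusterSize 1 2 (1 / 16) (1 / 50))
    (hSBHS : SereneBareHotSparseBPG (1 / 100) tameRadius 8 16 dressLevel dressLevel dressExponent 8 collarRadius clusterSize 1 2 (1 / 16) (1 / 50))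
    (hTBIS : TameBallIncoherenceSparseBPG (1 / 100) (1 / 200) tameRadius 8 1 2 (1 / 16) (1 / 50))
    (hG : PeriodicBulkGapDoor 2) : VisibleGap (1 / 50) ∧ PertRegime (1 / 50) :=
  gap_and_pert_1_50_of_certs_16XH18B_tol hL hL' hR hX hE hP hT hU h1 hGT hΛ0 hΛs hUc (untwistBookkeepingP_one 2 (1 / 50)) hl hN hF hE' hA hD hC
    (wildFractionBPG_of_dressedCore_serene_tameBallIncoherent (by norm_num [tameRadius]) (by norm_num) (by norm_num) (by norm_num) le_rfl hI hSBHS hTBIS) hG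

end Summit.AtomisticToContinuum.Crystallization.Theorems.ChartedZeroExcessLayeredLatticeLiouville

end
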